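import Summits.Ventures.HSemireg.WedgeHankelSiegelClassesStable
import Summits.Ventures.HSemireg.WedgeHankelClassSpaceAlgebra

/-!
# Venture HSemireg — THE KERNEL OF `g ↦ SbC(g)` IS THE GROUP OF `n`-TH ROOTS OF UNITY: for `n ≥ 1`, `SbC(α β γ δ) = 1` on th-7's classes iff `β = γ = 0`, `δ = α`, `α^n = 1`;
# hence two invertible letter maps act identically on the classes iff they differ by a scalar `t` with `t^n = 1`

HONEST FRAMING. Part of the Lean index of the computation cell `pub-hsemireg` (seat p10 gen 20, Sunday typer «UNIFORM-IN-n»).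
Finite-dimensional EXTERIOR ALGEBRA + linear algebra ONLY: no variety, no cohomology theory, no sheaf, no Ext group, no semiregularity map;
nothing here says that HC / HC_CM / HC_AV holds; no Literature fact is declared or used.  Custodian versions as in `WedgeHankelSiegelIdeal` (1/3) and `WedgeHankelFrameChange`;
the dictionary (the kernel of `GL₂ → GL(Sym^n)` is `μ_n`) is QUOTED, never asserted.

WHAT IS IN THE TREE.  J1 `Sb_w_spike_zero` (`Sb g E_0 = w_n(α^{n−j}β^j)`), J8 `Sb_w_spike_top` (`Sb g E_n = w_n(γ^{n−j}δ^j)`), I4 `Sb_diag_w_spike` (`Sb(a 0 0 d) E_p = a^{n−p}d^p E_p`),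
J5 (`WedgeHankelClassSpaceAlgebra`): `SbC_mul`, `SbC_scalar`, `SbC_smul`, `SbC_adj_mul`; H1b `w_eq_w_iff`.  THIS FILE (namespace `Summit.Ventures.HSemireg.Wedge.HankelFrameChange`
continued; imports J8, J5):
* §264 `Sb_w_spike_eq_of_SbC_eq_one` (a substitution acting trivially on the classes fixes every spike), **`SbC_eq_one_iff`: `n ≥ 1 ⇒ (SbC(α β γ δ) = 1 ⇔ β = 0 ∧ γ = 0 ∧ δ = α ∧
  α^n = 1)`** (read off `E_0`, `E_n`, `E_1`).
* §265 **`SbC_eq_SbC_iff`: for `αδ − βγ ≠ 0` and `n ≥ 1`, `SbC(g′) = SbC(g) ⇔ ∃ t, t^n = 1 ∧ g′ = t·g`** (entrywise), via `SbC(adj g)·SbC(g′) = SbC(g′·adj g)` (J5) and §264, and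
  the `n = 1` reading `SbC_eq_SbC_iff_one` (`SbC` is faithful on `GL₂` when `n = 1`).
NOT typed here: singular `g` (two singular letter maps with the same class action: same image letter line and proportional, by I12/J10); anything Ext-side.  New names only.
-/

open Module

namespace Summit.Ventures.HSemireg.Wedge.HankelFrameChange

open Summit.Ventures.HSemireg.Wedge Summit.Ventures.HSemireg.Wedge.Kunneth Summit.Ventures.HSemireg.Wedge.Hankel
  Summit.Ventures.HSemireg.Wedge.BasisFree Summit.Ventures.HSemireg.Wedge.HankelSiegel Summit.Ventures.HSemireg.Wedge.HankelSiegelIdeal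
  Summit.Ventures.HSemireg.Wedge.KunnethKernel Summit.Ventures.HSemireg.Wedge.HankelRankOne Summit.Ventures.HSemireg.Wedge.KernelDuality

variable (K : Type*) [Field K] {n : ℕ}

/-! ## §264. When does a substitution act trivially on the classes? -/

/-- a substitution acting as the identity on the class space fixes every class (as a form). -/
theorem Sb_w_eq_of_SbC_eq_one {α β γ δ : K} (h : SbC K α β γ δ (n := n) = 1) (q : ℕ → K) : Sb K α β γ δ (w K n n q) = w K n n q := by
  have e := congrArg (fun T : spikeSpan K n →ₗ[K] spikeSpan K n => ((T ⟨w K n n q, w_mem_spikeSpan K q⟩ : spikeSpan K n) : HT K (In n))) h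
  simpa only [SbC_apply_coe, Module.End.one_apply] using e

/-- **THE KERNEL OF `g ↦ SbC(g)` (`n ≥ 1`): `SbC(α β γ δ) = 1 ⇔ β = 0 ∧ γ = 0 ∧ δ = α ∧ α^n = 1`** — the scalar letter maps by `n`-th roots of unity (read off the images of
`E_0` (J1), `E_n` (J8) and `E_1` (I4 torus weights); conversely `SbC(α 0 0 α) = α^n • 1`, J5). -/
theorem SbC_eq_one_iff (hn : 1 ≤ n) (α β γ δ : K) : SbC K α β γ δ (n := n) = 1 ↔ β = 0 ∧ γ = 0 ∧ δ = α ∧ α ^ n = 1 := by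
  constructor
  · intro h
    -- `E_0 ↦ E_0`: `α^n = 1`, `α^{n−1}β = 0`
    have h0 := Sb_w_eq_of_SbC_eq_one K h (fun j => if j = 0 then (1 : K) else 0)
    rw [Sb_w_spike_zero, w_eq_w_iff] at h0
    have hαn : α ^ n = 1 := by have e := h0 0 (Nat.zero_le n); rwa [Nat.sub_zero, pow_zero, mul_one, if_pos rfl] at e
    have hα : α ≠ 0 := fun hz => by rw [hz, zero_pow (by omega)] at hαn; exact zero_ne_one hαn
    have hβ : β = 0 := by
      have e := h0 1 hn
      rw [pow_one, if_neg (by omega)] at e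
      exact (mul_eq_zero.mp e).resolve_left (pow_ne_zero _ hα)
    -- `E_n ↦ E_n`: `δ^n = 1`, `γδ^{n−1} = 0`
    have hN := Sb_w_eq_of_SbC_eq_one K h (fun j => if j = n then (1 : K) else 0)
    rw [Sb_w_spike_top, w_eq_w_iff] at hN
    have hδn : δ ^ n = 1 := by have e := hN n le_rfl; rwa [Nat.sub_self, pow_zero, one_mul, if_pos rfl] at e
    have hδ : δ ≠ 0 := fun hz => by rw [hz, zero_pow (by omega)] at hδn; exact zero_ne_one hδn
    have hγ : γ = 0 := by
      have e := hN (n - 1) (Nat.sub_le n 1)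
      rw [show n - (n - 1) = 1 by omega, pow_one, if_neg (by omega)] at e
      exact (mul_eq_zero.mp e).resolve_right (pow_ne_zero _ hδ)
    subst hβ hγ
    -- `E_1 ↦ E_1`: `α^{n−1}δ = 1 = α^{n−1}α`
    have h1 := Sb_w_eq_of_SbC_eq_one K h (fun j => if j = 1 then (1 : K) else 0)
    rw [Sb_diag_w_spike K α δ 1 le_rfl] at h1
    have hc : α ^ (n - 1) * δ ^ 1 = 1 := by
      by_contra hne
      have e : (α ^ (n - 1) * δ ^ 1 - 1) • w K n n (fun j => if j = 1 then (1 : K) else 0) = 0 := by rw [sub_smul, one_smul, h1, sub_self]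
      rw [smul_eq_zero] at e
      rcases e with e | e
      · exact hne (sub_eq_zero.mp e)
      · exact w_spike_ne_zero K hn e
    rw [pow_one] at hc
    have hαn' : α ^ (n - 1) * α = 1 := by rw [← pow_succ, Nat.sub_add_cancel hn, hαn]
    refine ⟨rfl, rfl, ?_, hαn⟩
    have := mul_left_cancel₀ (pow_ne_zero (n - 1) hα) (hc.trans hαn'.symm)
    exact this
  · rintro ⟨rfl, rfl, rfl, hαn⟩
    rw [SbC_scalar, hαn, one_smul]

/-! ## §265. Two substitutions with the same class action differ by an `n`-th root of unity -/

/-- **`SbC(g′) = SbC(g) ⇔ ∃ t, t^n = 1 ∧ g′ = t·g`** for `det g ≠ 0`, `n ≥ 1` (entrywise: `α′ = tα`, `β′ = tβ`, `γ′ = tγ`, `δ′ = tδ`). -/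
theorem SbC_eq_SbC_iff (hn : 1 ≤ n) {α β γ δ : K} (hdet : α * δ - β * γ ≠ 0) (α' β' γ' δ' : K) :
    SbC K α' β' γ' δ' (n := n) = SbC K α β γ δ ↔ ∃ t : K, t ^ n = 1 ∧ α' = t * α ∧ β' = t * β ∧ γ' = t * γ ∧ δ' = t * δ := by
  constructor
  · intro h
    -- `SbC(adj g)·SbC(g′) = SbC(g′·adj g)` equals `SbC(adj g)·SbC(g) = (det g)^n • 1`
    have h1 : SbC K δ (-β) (-γ) α (n := n) * SbC K α' β' γ' δ' = (α * δ - β * γ) ^ n • 1 := by rw [h, SbC_adj_mul]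
    rw [SbC_mul] at h1
    -- normalise by `d = det g`: `SbC(d⁻¹·(g′·adj g)) = 1`
    set d := α * δ - β * γ with hd
    have h2 : SbC K (d⁻¹ * (α' * δ + β' * -γ)) (d⁻¹ * (α' * -β + β' * α)) (d⁻¹ * (γ' * δ + δ' * -γ)) (d⁻¹ * (γ' * -β + δ' * α)) (n := n) = 1 := by
      rw [SbC_smul, h1, smul_smul, ← mul_pow, inv_mul_cancel₀ hdet, one_pow, one_smul]
    obtain ⟨e2, e3, e4, e1⟩ := (SbC_eq_one_iff K hn _ _ _ _).mp h2
    refine ⟨d⁻¹ * (α' * δ + β' * -γ), e1, ?_, ?_, ?_, ?_⟩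
    · -- `α′ = t α`
      have e2' : α' * β = β' * α := by
        have := mul_eq_zero.mp e2; rcases this with h0 | h0
        · exact absurd h0 (inv_ne_zero hdet)
        · linear_combination -h0
      field_simp
      linear_combination α' * hd - γ * e2'
    · have e2' : α' * β = β' * α := by
        have := mul_eq_zero.mp e2; rcases this with h0 | h0
        · exact absurd h0 (inv_ne_zero hdet)
        · linear_combination -h0
      field_simp
      linear_combination β' * hd - δ * e2'
    · have e3' : γ' * δ = δ' * γ := by
        have := mul_eq_zero.mp e3; rcases this with h0 | h0
        · exact absurd h0 (inv_ne_zero hdet)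
        · linear_combination h0
      have e4' : γ' * -β + δ' * α = α' * δ + β' * -γ := by
        have := mul_left_cancel₀ (inv_ne_zero hdet) e4
        exact this
      field_simp
      linear_combination γ' * hd + α * e3' + γ * e4'
    · have e3' : γ' * δ = δ' * γ := by
        have := mul_eq_zero.mp e3; rcases this with h0 | h0
        · exact absurd h0 (inv_ne_zero hdet)
        · linear_combination h0
      have e4' : γ' * -β + δ' * α = α' * δ + β' * -γ := mul_left_cancel₀ (inv_ne_zero hdet) e4
      field_simp
      linear_combination δ' * hd + β * e3' + δ * e4'
  · rintro ⟨t, ht, rfl, rfl, rfl, rfl⟩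
    rw [SbC_smul, ht, one_smul]

/-- `n = 1`: the class action is FAITHFUL on invertible letter maps (`t^1 = 1 ⇒ t = 1`). -/
theorem SbC_eq_SbC_iff_one {α β γ δ : K} (hdet : α * δ - β * γ ≠ 0) (α' β' γ' δ' : K) :
    SbC K α' β' γ' δ' (n := 1) = SbC K α β γ δ ↔ α' = α ∧ β' = β ∧ γ' = γ ∧ δ' = δ := by
  rw [SbC_eq_SbC_iff K le_rfl hdet]
  constructor
  · rintro ⟨t, ht, h1, h2, h3, h4⟩
    rw [pow_one] at ht
    subst ht
    simp only [one_mul] at h1 h2 h3 h4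
    exact ⟨h1, h2, h3, h4⟩
  · rintro ⟨rfl, rfl, rfl, rfl⟩
    exact ⟨1, one_pow 1, (one_mul _).symm, (one_mul _).symm, (one_mul _).symm, (one_mul _).symm⟩

end Summit.Ventures.HSemireg.Wedge.HankelFrameChange
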